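/-
Copyright (c) 2026 the pub-hodgecm-mathlib formalisation cell (harness21).  Prover seat hodgecm-mathlib-K2E4-p01 (g3), Track B ∕ K2-LIT,
h413 = `stmt-HodgeConjecture-24833`; #22S road F-C1 (K2E4-plan (g2) RULING (B) 2026-09-04T00:28:50Z): (GS^P) BY the REPORT-FIRST bytes
`K2/K2E4-p01/g3/GSP.sig.lean` v2 (sha16 23bb8bcde4c61eea).  2026-09-04.
-/
import Summits.HodgeConjecture.HodgeConjecture.Theorems.K2E3GLTwoRamifiedRayRankTwo    -- ★ FILE W (this seat): rank-two witnesses; transitively ★ FILE E (engine) and lineage g2's A B1 B2 C1 C2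
import HarnessLib

/-!
# h413 ∕ Track B «K2-LIT» — (GS^P): the CENTRAL GERM STRUCTURE of the canonical orbital integrals of `P = GL₂(F) × GL₁(F)`
# (two-term germ expansion on ONE ramified elliptic ray at a central point, central value from the constant term, rank two)

Cell `pub/hodgecm-mathlib`, crux H413 = `stmt-HodgeConjecture-24833` (supports-only).  Socket #22S `WeakMatrixRigidity.sig_K2E4WeakMatrixFiniteTransportSplit`
(WMR ED. 3 :447) ⟸ ★ p856157 `weakMatrixFiniteTransportSplit_of_socketsR` ∘ (GS_v′) ∘ (LIFT_v) (K2E4-p18 (g2) REPORT-22 §3, K2E4-p07 (g3) 00:32:27Z);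
(GS_v′) = K2E4-p07 (g3)'s T0-style transport `Theorems/K2E3CentralGermStructureSplitOfGSP.lean` of THIS FILE's theorem
**`exists_ellipticRay_orbitalIntegral_eq_add_mul`** (statement = `K2/K2E4-p01/g3/GSP.sig.lean` v2 token for token):

for a Haar measure `ν` on `P` and a centre `(z·1₂, c·1₁)` there are a ray `γ_n → (z·1₂, c·1₁)` of elliptic-regular elements, `G_n` with infinitely many
values, `λ ≠ 0`, `λ′`, such that (i) every `γ_n` passes the two (HC₁^P) guards, (ii) each `C_P(γ_n)` carries a compactCore-normalised Haar measure,
(iii) for EVERY `ψ ∈ C_c^∞(P)` there are `a, b` with `O_{γ_n}^{ν∕ρ}(ψ) = a + b·G_n` for `n ≫ 0` and every normalised `ρ`, and `ψ(z·1₂, c·1₁) = λa + λ′b`,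
(iv) two test functions have linearly independent germ pairs.

PROOF.  `γ_n = (z(1 + ϖⁿτ), c·1₁)` on the Eisenstein torus `τ² = uτ + v` of ★ C2, `G_n = qⁿ`, `λ = −(q−1)∕ν(K_P)`, `λ′ = 0`.
(iii): average `ψ` over finitely many `K_P`-conjugates (★ `exists_finset_conj_sum_invariant_of_hasCompactSupport`; canonical orbital integrals are
conjugation invariant, ★ `orbitalIntegral_conj_eq`) and apply ★ FILE E `orbitalIntegral_deep_eq_closedForm`.  (iv): the witnesses
`ψ₁ = 1_{(z·1₂,c)K_P}`, `ψ₂ = ψ₁ − 1_{(z·1₂,c)(K(ϖ)×GL₁(𝒪))}` of ★ FILE W have `S_1 = 1 + q` resp. `q`, central values `1` resp. `0`, hence germ pairs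
`(−w∕(q−1), wq∕(q−1))` and `(0, w)`, `w = ν(K_P)`, determinant `−w²∕(q−1) ≠ 0`.

HONEST LABEL: HC_CM is proved only modulo the 7 printed citations (2 remaining named inputs: hLiu418 = `stmt-HodgeConjecture-24832`,
h413 = `stmt-HodgeConjecture-24833`) until rung 0 closes; this file is an unconditional local theorem and moves no counter by itself.

## References
* [LabesseLanglands1979] J.-P. Labesse, R. P. Langlands, *L-indistinguishability for SL(2)*, Canad. J. Math. 31 (1979), §2 pp. 7–9.
* [HarishChandra1999AdmissibleDistributions] Harish-Chandra (DeBacker–Sally), *Admissible Invariant Distributions on Reductive p-adic Groups*, AMS ULS 16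
  (1999), Thm. 3.1.
* [Rogawski1990] J. D. Rogawski, *Automorphic Representations of Unitary Groups in Three Variables* (1990), §8.1 Props. 8.1.1–8.1.3 pp. 114–116; §4.9 p. 54.
-/

set_option autoImplicit false
set_option linter.dupNamespace false

noncomputable section

open scoped ValuativeRel Matrix MatrixGroups ENNReal
open Matrix ValuativeRel MeasureTheory Measure Topology Filter
open Literature.MeasureTheory.Group Literature.NumberTheory.Automorphic Literature.NumberTheory.Automorphic.HermitianLatticeTree
open Literature.NumberTheory.Rogawski1990 (IsLocSmooth isLocSmooth_indicator)
open Summit.HodgeConjecture.HodgeConjecture.Cruxes.H413.K2E3GLTwoRamifiedShellShift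
open Summit.HodgeConjecture.HodgeConjecture.Cruxes.H413.K2E3GLTwoRamifiedShellStabilizers
open Summit.HodgeConjecture.HodgeConjecture.Cruxes.H413.K2E3GLTwoRamifiedShellUnfolding
open Summit.HodgeConjecture.HodgeConjecture.Cruxes.H413.K2E3GLTwoRamifiedTorusCompactCore
open Summit.HodgeConjecture.HodgeConjecture.Cruxes.H413.K2E3GLTwoRamifiedRayGermEngine
open Summit.HodgeConjecture.HodgeConjecture.Cruxes.H413.K2E3GLTwoRamifiedRayRankTwo

namespace Summit.HodgeConjecture.HodgeConjecture.Cruxes.H413.K2E3GLTwoCentralGermRamifiedRay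

variable {F : Type*} [Field F] [ValuativeRel F] [TopologicalSpace F] [IsNonarchimedeanLocalField F]

/-! ## §1 Finite `K_P`-averages have `nK`-fold canonical orbital integrals -/

section Average

variable [MeasurableSpace (GL (Fin 2) F × GL (Fin 1) F)] [BorelSpace (GL (Fin 2) F × GL (Fin 1) F)]
  [T2Space (GL (Fin 2) F × GL (Fin 1) F)] [LocallyCompactSpace (GL (Fin 2) F × GL (Fin 1) F)]
  [SecondCountableTopology (GL (Fin 2) F × GL (Fin 1) F)]
  [∀ Γ : GL (Fin 2) F × GL (Fin 1) F, MeasurableSpace ((GL (Fin 2) F × GL (Fin 1) F) ⧸ Subgroup.centralizer ({Γ} : Set (GL (Fin 2) F × GL (Fin 1) F)))]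
  [∀ Γ : GL (Fin 2) F × GL (Fin 1) F, BorelSpace ((GL (Fin 2) F × GL (Fin 1) F) ⧸ Subgroup.centralizer ({Γ} : Set (GL (Fin 2) F × GL (Fin 1) F)))]

/-- **A finite sum of conjugates has `nK` times the canonical orbital integral** (the quotient measure `ν∕ρ` is invariant, ★ `orbitalIntegral_conj_eq`).
[cite: Rogawski1990, §4.9 p. 54] -/
theorem orbitalIntegral_sum_conj_eq (Γ : GL (Fin 2) F × GL (Fin 1) F)
    (hO : IsClosed {g : GL (Fin 2) F × GL (Fin 1) F | ∃ y : GL (Fin 2) F × GL (Fin 1) F, y * Γ * y⁻¹ = g})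
    {ψ : GL (Fin 2) F × GL (Fin 1) F → ℂ} (hψc : Continuous ψ) (hψs : HasCompactSupport ψ) {nK : ℕ} (kf : Fin nK → GL (Fin 2) F × GL (Fin 1) F)
    (ρ : Measure (Subgroup.centralizer ({Γ} : Set (GL (Fin 2) F × GL (Fin 1) F)))) [ρ.IsHaarMeasure] [ρ.IsInvInvariant]
    (ν : Measure (GL (Fin 2) F × GL (Fin 1) F)) [ν.IsHaarMeasure] [ν.IsMulRightInvariant] :
    orbitalIntegral Γ (fun x => ∑ i, ψ (kf i * x * (kf i)⁻¹))
        (quotientMeasure (Subgroup.centralizer ({Γ} : Set (GL (Fin 2) F × GL (Fin 1) F))) ρ (isClosed_coe_centralizer_singleton Γ) ν) =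
      (nK : ℂ) * orbitalIntegral Γ ψ (quotientMeasure (Subgroup.centralizer ({Γ} : Set (GL (Fin 2) F × GL (Fin 1) F))) ρ (isClosed_coe_centralizer_singleton Γ) ν) := by
  classical
  haveI := smulInvariantMeasure_quotientMeasure (Subgroup.centralizer ({Γ} : Set (GL (Fin 2) F × GL (Fin 1) F))) ρ (isClosed_coe_centralizer_singleton Γ) ν
  have hterm : ∀ i, orbitalIntegral Γ (fun x => ψ (kf i * x * (kf i)⁻¹))
      (quotientMeasure (Subgroup.centralizer ({Γ} : Set (GL (Fin 2) F × GL (Fin 1) F))) ρ (isClosed_coe_centralizer_singleton Γ) ν) =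
      orbitalIntegral Γ ψ (quotientMeasure (Subgroup.centralizer ({Γ} : Set (GL (Fin 2) F × GL (Fin 1) F))) ρ (isClosed_coe_centralizer_singleton Γ) ν) :=
    fun i => orbitalIntegral_conj_eq Γ _ (kf i) ψ
  -- the orbital integral of the finite sum is the sum of the orbital integrals (each integrand is integrable at the closed class)
  rw [orbitalIntegral_eq_integral_descConj]
  have hpt : descConj Γ (Subgroup.centralizer ({Γ} : Set (GL (Fin 2) F × GL (Fin 1) F))) (fun _ hg => Subgroup.mem_centralizer_singleton_iff.1 hg)
      (fun x => ∑ i, ψ (kf i * x * (kf i)⁻¹)) =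
      fun y => ∑ i, descConj Γ (Subgroup.centralizer ({Γ} : Set (GL (Fin 2) F × GL (Fin 1) F)))
        (fun _ hg => Subgroup.mem_centralizer_singleton_iff.1 hg) (fun x => ψ (kf i * x * (kf i)⁻¹)) y := by
    funext y
    induction y using QuotientGroup.induction_on with
    | H g => simp only [descConj_mk]
  have hint : ∀ i, Integrable (descConj Γ (Subgroup.centralizer ({Γ} : Set (GL (Fin 2) F × GL (Fin 1) F)))
      (fun _ hg => Subgroup.mem_centralizer_singleton_iff.1 hg) (fun x => ψ (kf i * x * (kf i)⁻¹)))
      (quotientMeasure (Subgroup.centralizer ({Γ} : Set (GL (Fin 2) F × GL (Fin 1) F))) ρ (isClosed_coe_centralizer_singleton Γ) ν) := fun i =>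
    integrable_descConj_of_isClosed Γ hO (hψc.comp ((continuous_const.mul continuous_id).mul continuous_const))
      (Literature.Topology.hasCompactSupport_conj hψs (kf i)) _
  rw [hpt, integral_finsetSum _ fun i _ => hint i]
  simp_rw [← orbitalIntegral_eq_integral_descConj, hterm]
  rw [Finset.sum_const, Finset.card_univ, Fintype.card_fin, nsmul_eq_mul]

end Average

/-! ## §2 (GS^P) -/

section Main

set_option maxHeartbeats 800000 in
/-- **(GS^P) CENTRAL GERM STRUCTURE ON `P = GL₂(F) × GL₁(F)`** (two-term germ expansion on a ramified elliptic ray + central value + rank two):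
for every central `(z·1₂, c)` there are a ray `γ_n → (z·1₂, c)` of elliptic-regular elements (`tr² − 4 det ≠ 0`, `χ_{γ_n.1}(γ_n.2) ≠ 0`), a sequence
`G_n` with infinitely many values and constants `λ ≠ 0`, `λ′` such that every `ψ ∈ C_c^∞(P)` has `a, b` with
`O_{γ_n}^{ν∕ρ}(ψ) = a + b·G_n` for `n ≫ 0` (every compactCore-normalised Haar `ρ` on `C_P(γ_n)`) and `ψ(z·1₂, c) = λa + λ′b`; and two test functions
have linearly independent germ pairs.  (Ray `γ_n = (z(1 + ϖⁿτ), c)` on one Eisenstein torus `τ² = uτ + v`, `G_n = qⁿ`, `λ′ = 0`.)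
BYTES = `K2/K2E4-p01/g3/GSP.sig.lean` v2 (interface with K2E4-p07 (g3)'s F-C2 transport to (GS_v′)).
[cite: LabesseLanglands1979, §2 pp. 7–9] [cite: HarishChandra1999AdmissibleDistributions, Thm. 3.1] [cite: Rogawski1990, §8.1 Props. 8.1.1–8.1.3 pp. 114–116] -/
theorem exists_ellipticRay_orbitalIntegral_eq_add_mul
    [MeasurableSpace (GL (Fin 2) F × GL (Fin 1) F)] [BorelSpace (GL (Fin 2) F × GL (Fin 1) F)]
    [T2Space (GL (Fin 2) F × GL (Fin 1) F)] [LocallyCompactSpace (GL (Fin 2) F × GL (Fin 1) F)]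
    [SecondCountableTopology (GL (Fin 2) F × GL (Fin 1) F)]
    [∀ γ : GL (Fin 2) F × GL (Fin 1) F,
      MeasurableSpace ((GL (Fin 2) F × GL (Fin 1) F) ⧸ Subgroup.centralizer ({γ} : Set (GL (Fin 2) F × GL (Fin 1) F)))]
    [∀ γ : GL (Fin 2) F × GL (Fin 1) F,
      BorelSpace ((GL (Fin 2) F × GL (Fin 1) F) ⧸ Subgroup.centralizer ({γ} : Set (GL (Fin 2) F × GL (Fin 1) F)))]
    (ν : Measure (GL (Fin 2) F × GL (Fin 1) F)) [ν.IsHaarMeasure] [ν.IsMulRightInvariant] (z c : Fˣ) :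
    ∃ (γ : ℕ → GL (Fin 2) F × GL (Fin 1) F) (G : ℕ → ℂ) (lam lam' : ℂ),
      (∀ n, ((γ n).1 : Matrix (Fin 2) (Fin 2) F).trace ^ 2 - 4 * ((γ n).1 : Matrix (Fin 2) (Fin 2) F).det ≠ 0 ∧
        (((γ n).1 : Matrix (Fin 2) (Fin 2) F).charpoly).eval (((γ n).2 : Matrix (Fin 1) (Fin 1) F) 0 0) ≠ 0) ∧
      (∀ n, ∃ ρ : Measure (Subgroup.centralizer ({γ n} : Set (GL (Fin 2) F × GL (Fin 1) F))),
        ρ.IsHaarMeasure ∧ ρ.IsInvInvariant ∧ ρ (compactCore (Subgroup.centralizer ({γ n} : Set (GL (Fin 2) F × GL (Fin 1) F)))) = 1) ∧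
      Tendsto γ atTop (𝓝 (Units.map (Matrix.scalar (Fin 2) : F →+* Matrix (Fin 2) (Fin 2) F).toMonoidHom z,
        Units.map (Matrix.scalar (Fin 1) : F →+* Matrix (Fin 1) (Fin 1) F).toMonoidHom c)) ∧
      (Set.range G).Infinite ∧ lam ≠ 0 ∧
      (∀ ψ : GL (Fin 2) F × GL (Fin 1) F → ℂ, IsLocSmooth ψ →
        ∃ a b : ℂ,
          (∀ᶠ n in atTop, ∀ (ρ : Measure (Subgroup.centralizer ({γ n} : Set (GL (Fin 2) F × GL (Fin 1) F))))
              [ρ.IsHaarMeasure] [ρ.IsInvInvariant],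
              ρ (compactCore (Subgroup.centralizer ({γ n} : Set (GL (Fin 2) F × GL (Fin 1) F)))) = 1 →
              orbitalIntegral (γ n) ψ
                (quotientMeasure (Subgroup.centralizer ({γ n} : Set (GL (Fin 2) F × GL (Fin 1) F))) ρ
                  (isClosed_coe_centralizer_singleton (γ n)) ν) = a + b * G n) ∧
          ψ (Units.map (Matrix.scalar (Fin 2) : F →+* Matrix (Fin 2) (Fin 2) F).toMonoidHom z,
              Units.map (Matrix.scalar (Fin 1) : F →+* Matrix (Fin 1) (Fin 1) F).toMonoidHom c) = lam * a + lam' * b) ∧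
      (∃ (ψ₁ ψ₂ : GL (Fin 2) F × GL (Fin 1) F → ℂ) (a₁ b₁ a₂ b₂ : ℂ), IsLocSmooth ψ₁ ∧ IsLocSmooth ψ₂ ∧
        (∀ᶠ n in atTop, ∀ (ρ : Measure (Subgroup.centralizer ({γ n} : Set (GL (Fin 2) F × GL (Fin 1) F))))
            [ρ.IsHaarMeasure] [ρ.IsInvInvariant],
            ρ (compactCore (Subgroup.centralizer ({γ n} : Set (GL (Fin 2) F × GL (Fin 1) F)))) = 1 →
            orbitalIntegral (γ n) ψ₁
              (quotientMeasure (Subgroup.centralizer ({γ n} : Set (GL (Fin 2) F × GL (Fin 1) F))) ρ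
                (isClosed_coe_centralizer_singleton (γ n)) ν) = a₁ + b₁ * G n) ∧
        (∀ᶠ n in atTop, ∀ (ρ : Measure (Subgroup.centralizer ({γ n} : Set (GL (Fin 2) F × GL (Fin 1) F))))
            [ρ.IsHaarMeasure] [ρ.IsInvInvariant],
            ρ (compactCore (Subgroup.centralizer ({γ n} : Set (GL (Fin 2) F × GL (Fin 1) F)))) = 1 →
            orbitalIntegral (γ n) ψ₂
              (quotientMeasure (Subgroup.centralizer ({γ n} : Set (GL (Fin 2) F × GL (Fin 1) F))) ρ
                (isClosed_coe_centralizer_singleton (γ n)) ν) = a₂ + b₂ * G n) ∧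
        a₁ * b₂ - a₂ * b₁ ≠ 0) := by
  classical
  haveI : T2Space F := t2Space_of_isNonarchimedeanLocalField
  obtain ⟨ϖ, hϖ⟩ := exists_isUniformizingElement (F := F)
  -- an Eisenstein torus with non-zero discriminant (`τ² = ϖτ + ϖ` in characteristic `2`, `τ² = ϖ` otherwise), as in ★ C2
  obtain ⟨u, v, hu, hu1, hv1, hdisc⟩ : ∃ u v : F, u ∈ 𝒪[F] ∧ valuation F u < 1 ∧ valuation F v = valuation F ϖ ∧ u ^ 2 + 4 * v ≠ 0 := by
    have h4 : (4 : F) = 2 * 2 := by norm_num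
    by_cases h2 : (2 : F) = 0
    · refine ⟨ϖ, ϖ, hϖ.mem, hϖ.valuation_lt_one, rfl, ?_⟩
      rw [h4, h2, zero_mul, zero_mul, add_zero]
      exact pow_ne_zero _ hϖ.ne_zero
    · refine ⟨0, ϖ, Subring.zero_mem _, by rw [map_zero]; exact zero_lt_one, rfl, ?_⟩
      rw [zero_pow two_ne_zero, zero_add, h4]
      exact mul_ne_zero (mul_ne_zero h2 h2) hϖ.ne_zero
  have h0 := hϖ.ne_zero
  have hv : v ∈ 𝒪[F] := by rw [Valuation.mem_integer_iff, hv1]; exact hϖ.valuation_le_one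
  have hv0 : v ≠ 0 := fun h => by rw [h, map_zero] at hv1; exact (Valuation.ne_zero_iff _).2 h0 hv1.symm
  have hE := quadNormForm_integral_of_eisenstein hϖ hu hu1 hv1
  -- the centre `(z·1₂, c·1₁)`
  set zS := Units.map (Matrix.scalar (Fin 2) : F →+* Matrix (Fin 2) (Fin 2) F).toMonoidHom z with hzSdef
  set cu := Units.map (Matrix.scalar (Fin 1) : F →+* Matrix (Fin 1) (Fin 1) F).toMonoidHom c with hcudef
  have hzS : (zS : Matrix (Fin 2) (Fin 2) F) = !![(z : F), 0; 0, z] := by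
    rw [hzSdef, Units.coe_map]
    ext i j
    fin_cases i <;> fin_cases j <;> simp [Matrix.scalar_apply]
  have hcu : ((cu : Matrix (Fin 1) (Fin 1) F) 0 0) = (c : F) := by
    rw [hcudef, Units.coe_map]; simp [Matrix.scalar_apply]
  have hcomm : ∀ x : GL (Fin 2) F × GL (Fin 1) F, ((zS, cu) : GL (Fin 2) F × GL (Fin 1) F) * x = x * (zS, cu) := fun x =>
    Prod.ext (units_map_scalar_mul_comm z x.1) (glOne_mul_comm cu x.2)
  -- the torus, the deep ray `γ_n = z(1 + ϖⁿτ)`, the shell representatives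
  set γτ : GL (Fin 2) F := Matrix.GeneralLinearGroup.mkOfDetNeZero !![0, v; 1, u] (by rw [Matrix.det_fin_two]; simp [hv0]) with hγτdef
  have hγτ : (γτ : Matrix (Fin 2) (Fin 2) F) = !![0, v; 1, u] := rfl
  have hδ : ∀ n : ℕ, valuation F (1 + ϖ ^ n * u - ϖ ^ (2 * n) * v) = 1 := fun n => by
    have h1 : valuation F (ϖ ^ n * u - ϖ ^ (2 * n) * v) < 1 := by
      refine lt_of_le_of_lt (Valuation.map_sub _ _ _) (max_lt ?_ ?_)
      · rw [map_mul, map_pow]; exact mul_lt_one_of_nonneg_of_lt_one_right (pow_le_one₀ zero_le hϖ.valuation_lt_one.le) zero_le hu1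
      · rw [map_mul, map_pow, hv1]
        exact mul_lt_one_of_nonneg_of_lt_one_right (pow_le_one₀ zero_le hϖ.valuation_lt_one.le) zero_le hϖ.valuation_lt_one
    rw [add_sub_assoc, Valuation.map_one_add_of_lt _ h1]
  have hdet : ∀ n : ℕ, Matrix.det !![(z : F), z * ϖ ^ n * v; z * ϖ ^ n, z + z * ϖ ^ n * u] ≠ 0 := fun n => by
    have : Matrix.det !![(z : F), z * ϖ ^ n * v; z * ϖ ^ n, z + z * ϖ ^ n * u] = (z : F) ^ 2 * (1 + ϖ ^ n * u - ϖ ^ (2 * n) * v) := by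
      rw [Matrix.det_fin_two]; simp; ring
    rw [this]
    refine mul_ne_zero (pow_ne_zero _ z.ne_zero) fun h => ?_
    have := hδ n
    rw [h, map_zero] at this
    exact zero_ne_one this
  set γ : ℕ → GL (Fin 2) F := fun n => Matrix.GeneralLinearGroup.mkOfDetNeZero _ (hdet n) with hγdef
  have hγ : ∀ n, (γ n : Matrix (Fin 2) (Fin 2) F) = !![(z : F), z * ϖ ^ n * v; z * ϖ ^ n, z + z * ϖ ^ n * u] := fun n => rfl
  have hb : ∀ n : ℕ, (z : F) * ϖ ^ n ≠ 0 := fun n => mul_ne_zero z.ne_zero (pow_ne_zero _ h0)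
  set rm : ℕ → GL (Fin 2) F := fun m => Matrix.GeneralLinearGroup.mkOfDetNeZero (Matrix.diagonal ![(1 : F), ϖ ^ m])
    (by rw [Matrix.det_diagonal]; simp [h0]) with hrmdef
  have hrm : ∀ m, (rm m : Matrix (Fin 2) (Fin 2) F) = Matrix.diagonal ![(1 : F), ϖ ^ m] := fun m => rfl
  have hCn : ∀ n, Subgroup.centralizer ({γ n} : Set (GL (Fin 2) F)) = Subgroup.centralizer ({γτ} : Set (GL (Fin 2) F)) := fun n =>
    centralizer_deep_eq_centralizer_companion (hb n) (hγ n) hγτ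
  have hdisc' : ∀ n, (γ n : Matrix (Fin 2) (Fin 2) F).trace ^ 2 - 4 * (γ n : Matrix (Fin 2) (Fin 2) F).det ≠ 0 := fun n => by
    rw [trace_sq_sub_four_mul_det_regRep u v (z : F) (z * ϖ ^ n) (hγ n)]
    exact mul_ne_zero (pow_ne_zero _ (hb n)) hdisc
  have heval : ∀ n, ((γ n : Matrix (Fin 2) (Fin 2) F).charpoly).eval ((cu : Matrix (Fin 1) (Fin 1) F) 0 0) ≠ 0 := fun n => by
    rw [hcu]; exact eval_charpoly_regRep_ne_zero hϖ hE (hb n) (c : F) (hγ n)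
  have hOcl : ∀ n, IsClosed {g : GL (Fin 2) F × GL (Fin 1) F | ∃ y : GL (Fin 2) F × GL (Fin 1) F, y * (γ n, cu) * y⁻¹ = g} := fun n =>
    isClosed_conjClass_pair (γ n) (hdisc' n) cu
  -- `K_P`, `q = |𝓀|`, `w = ν(K_P)`
  have hKo : IsOpen (((glInt 2 F).prod (glInt 1 F) : Subgroup (GL (Fin 2) F × GL (Fin 1) F)) : Set (GL (Fin 2) F × GL (Fin 1) F)) := isOpen_prodGlInt
  have hKc : IsCompact (((glInt 2 F).prod (glInt 1 F) : Subgroup (GL (Fin 2) F × GL (Fin 1) F)) : Set (GL (Fin 2) F × GL (Fin 1) F)) :=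
    isCompact_prodGlInt
  have hcard : 1 < Nat.card (IsLocalRing.ResidueField 𝒪[F]) := Finite.one_lt_card
  have hq1 : (Nat.card (IsLocalRing.ResidueField 𝒪[F]) : ℂ) - 1 ≠ 0 := by
    have h1 : (Nat.card (IsLocalRing.ResidueField 𝒪[F]) : ℂ) ≠ 1 := by exact_mod_cast hcard.ne'
    exact sub_ne_zero.2 h1
  have hq0 : (Nat.card (IsLocalRing.ResidueField 𝒪[F]) : ℂ) ≠ 0 := by exact_mod_cast (zero_lt_one.trans hcard).ne'
  have hw0 : ((ν ((glInt 2 F).prod (glInt 1 F))).toReal : ℂ) ≠ 0 := by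
    rw [Complex.ofReal_ne_zero, ENNReal.toReal_ne_zero]
    exact ⟨(hKo.measure_pos ν ⟨1, Subgroup.one_mem _⟩).ne', hKc.measure_lt_top.ne⟩
  refine ⟨fun n => (γ n, cu), fun n => (Nat.card (IsLocalRing.ResidueField 𝒪[F]) : ℂ) ^ n,
    -((Nat.card (IsLocalRing.ResidueField 𝒪[F]) : ℂ) - 1) / ((ν ((glInt 2 F).prod (glInt 1 F))).toReal : ℂ), 0, fun n => ⟨hdisc' n, heval n⟩,
    fun n => exists_isHaarMeasure_compactCore_centralizer_pair_eq_one hϖ hu hu1 hv1 hγτ (hCn n) cu,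
    tendsto_deep hϖ hu hv (z : F) cu hγ hzS, ?_, div_ne_zero (neg_ne_zero.2 hq1) hw0, ?_, ?_⟩
  · -- `G_n = qⁿ` takes infinitely many values
    refine Set.infinite_range_of_injective fun a b hab => ?_
    have hab' : (Nat.card (IsLocalRing.ResidueField 𝒪[F])) ^ a = (Nat.card (IsLocalRing.ResidueField 𝒪[F])) ^ b := by exact_mod_cast hab
    exact Nat.pow_right_injective hcard hab'
  · -- (iii) the germ of an arbitrary smooth `ψ`: finite `K_P`-average `Ψ`, then ★ FILE E on `Ψ`, then `O(Ψ) = nK·O(ψ)` (§1)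
    intro ψ hψ
    obtain ⟨nK, kf, hnK, -, hinv⟩ :=
      Literature.Topology.exists_finset_conj_sum_invariant_of_hasCompactSupport (K := (glInt 2 F).prod (glInt 1 F)) hKc hψ.1 hψ.2
    obtain ⟨Ψ, hΨ⟩ : ∃ Ψ : GL (Fin 2) F × GL (Fin 1) F → ℂ, Ψ = fun x => ∑ i, ψ (kf i * x * (kf i)⁻¹) := ⟨_, rfl⟩
    have hΨs : IsLocSmooth Ψ := by
      rw [hΨ]; exact ⟨Literature.Topology.isLocallyConstant_sum_conj hψ.1 kf, Literature.Topology.hasCompactSupport_sum_conj hψ.2 kf⟩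
    have hΨK : ∀ k ∈ (glInt 2 F).prod (glInt 1 F), ∀ y, Ψ (k * y * k⁻¹) = Ψ y := fun k hk y => by rw [hΨ]; exact hinv k hk y
    have hnK0 : (nK : ℂ) ≠ 0 := by exact_mod_cast hnK.ne'
    -- a right-invariance level `m ≥ 1` of `Ψ` in the `GL₂` variable
    obtain ⟨V, hV, hVΨ⟩ := Literature.Topology.exists_nhds_one_forall_mul_eq_of_hasCompactSupport hΨs.1 hΨs.2
    have hU : (fun g : GL (Fin 2) F => ((g, 1) : GL (Fin 2) F × GL (Fin 1) F)) ⁻¹' V ∈ 𝓝 (1 : GL (Fin 2) F) :=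
      (continuous_id.prodMk continuous_const).continuousAt.preimage_mem_nhds (by exact hV)
    obtain ⟨m, hm, hmU⟩ := exists_congruenceGL_pow_subset hϖ hU
    have hright : ∀ k ∈ congruenceGL 2 (valuation F ϖ ^ m), ∀ x : GL (Fin 2) F, Ψ (x * k, cu) = Ψ (x, cu) := fun k hk x => by
      have := hVΨ (x, cu) (k, 1) (hmU hk)
      simpa only [Prod.mk_mul_mk, mul_one] using this
    -- a shell bound of the support at depth `m`; the explicit germ of `Ψ` (★ FILE E); `Ψ(z·1₂,c) = nK·ψ(z·1₂,c)`
    obtain ⟨R, hR⟩ := exists_forall_le_apply_shellConj_eq_zero hϖ hu hv hE hγτ (hCn m) cu hrm (hOcl m) hΨs.2 hΨK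
    have hgerm := fun k : ℕ => orbitalIntegral_deep_eq_closedForm hϖ hu hu1 hv1 hdisc z cu hγτ hγ hrm hzS ν hΨs.continuous hΨs.2 hΨK hm hright hR k
    have hcent : Ψ (zS, cu) = (nK : ℂ) * ψ (zS, cu) := by
      have h1 : ∀ i, kf i * ((zS, cu) : GL (Fin 2) F × GL (Fin 1) F) * (kf i)⁻¹ = (zS, cu) := fun i => by
        rw [← hcomm (kf i), mul_inv_cancel_right]
      simp only [hΨ, h1, Finset.sum_const, Finset.card_univ, Fintype.card_fin, nsmul_eq_mul]
    refine ⟨-(((ν ((glInt 2 F).prod (glInt 1 F))).toReal : ℂ) * ψ (zS, cu)) / ((Nat.card (IsLocalRing.ResidueField 𝒪[F]) : ℂ) - 1),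
      (nK : ℂ)⁻¹ * ((ν ((glInt 2 F).prod (glInt 1 F))).toReal : ℂ) *
        ((∑ r ∈ Finset.range R, ((Nat.card (IsLocalRing.ResidueField 𝒪[F]) : ℂ) ^ r) *
            Ψ ((((rm r)⁻¹, 1) : GL (Fin 2) F × GL (Fin 1) F) * (γ m, cu) * (((rm r)⁻¹, 1) : GL (Fin 2) F × GL (Fin 1) F)⁻¹)) +
          (nK : ℂ) * ψ (zS, cu) / ((Nat.card (IsLocalRing.ResidueField 𝒪[F]) : ℂ) - 1)) /
        (Nat.card (IsLocalRing.ResidueField 𝒪[F]) : ℂ) ^ m, ?_, ?_⟩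
    · refine Filter.eventually_atTop.2 ⟨m, fun n hn => ?_⟩
      obtain ⟨k, rfl⟩ := Nat.exists_eq_add_of_le hn
      intro ρ _ _ hρ
      have h1 := hgerm k ρ hρ
      have h2 : orbitalIntegral (γ (m + k), cu) Ψ (quotientMeasure (Subgroup.centralizer ({(γ (m + k), cu)} : Set (GL (Fin 2) F × GL (Fin 1) F))) ρ
          (isClosed_coe_centralizer_singleton (γ (m + k), cu)) ν) =
          (nK : ℂ) * orbitalIntegral (γ (m + k), cu) ψ (quotientMeasure (Subgroup.centralizer ({(γ (m + k), cu)} : Set (GL (Fin 2) F × GL (Fin 1) F))) ρ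
          (isClosed_coe_centralizer_singleton (γ (m + k), cu)) ν) := by
        rw [hΨ]; exact orbitalIntegral_sum_conj_eq (γ (m + k), cu) (hOcl (m + k)) hψ.continuous hψ.2 kf ρ ν
      have h3 : orbitalIntegral (γ (m + k), cu) ψ (quotientMeasure (Subgroup.centralizer ({(γ (m + k), cu)} : Set (GL (Fin 2) F × GL (Fin 1) F))) ρ
          (isClosed_coe_centralizer_singleton (γ (m + k), cu)) ν) =
          (nK : ℂ)⁻¹ * orbitalIntegral (γ (m + k), cu) Ψ (quotientMeasure (Subgroup.centralizer ({(γ (m + k), cu)} : Set (GL (Fin 2) F × GL (Fin 1) F))) ρ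
          (isClosed_coe_centralizer_singleton (γ (m + k), cu)) ν) := by
        rw [h2, ← mul_assoc, inv_mul_cancel₀ hnK0, one_mul]
      refine h3.trans ?_
      rw [h1, hcent]
      beta_reduce
      rw [pow_add]
      field_simp
      ring
    · rw [zero_mul, add_zero]
      field_simp
  · -- (iv) RANK TWO: the witnesses of ★ FILE W
    have hval0 : valuation F ϖ ^ 1 ≠ 0 := pow_ne_zero _ ((Valuation.ne_zero_iff _).2 h0)
    have hK'o : IsOpen (((congruenceGL 2 (valuation F ϖ ^ 1)).prod (glInt 1 F) : Subgroup (GL (Fin 2) F × GL (Fin 1) F)) : Set (GL (Fin 2) F × GL (Fin 1) F)) := by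
      rw [Subgroup.coe_prod]; exact (isOpen_congruenceGL (n := 2) hval0).prod (isOpen_glInt 1 F)
    have hK'c : IsCompact (((congruenceGL 2 (valuation F ϖ ^ 1)).prod (glInt 1 F) : Subgroup (GL (Fin 2) F × GL (Fin 1) F)) : Set (GL (Fin 2) F × GL (Fin 1) F)) := by
      rw [Subgroup.coe_prod]; exact (isCompact_congruenceGL (n := 2) _).prod (isCompact_glInt 1 F)
    -- the two test sets `U₁ = (z·1₂,c)·K_P`, `U₂ = (z·1₂,c)·(K(ϖ) × GL₁(𝒪))` and their indicators
    obtain ⟨U₁, hU₁⟩ : ∃ U : Set (GL (Fin 2) F × GL (Fin 1) F), U = (fun y => ((zS, cu) : GL (Fin 2) F × GL (Fin 1) F)⁻¹ * y) ⁻¹'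
        (((glInt 2 F).prod (glInt 1 F) : Subgroup (GL (Fin 2) F × GL (Fin 1) F)) : Set (GL (Fin 2) F × GL (Fin 1) F)) := ⟨_, rfl⟩
    obtain ⟨U₂, hU₂⟩ : ∃ U : Set (GL (Fin 2) F × GL (Fin 1) F), U = (fun y => ((zS, cu) : GL (Fin 2) F × GL (Fin 1) F)⁻¹ * y) ⁻¹'
        (((congruenceGL 2 (valuation F ϖ ^ 1)).prod (glInt 1 F) : Subgroup (GL (Fin 2) F × GL (Fin 1) F)) : Set (GL (Fin 2) F × GL (Fin 1) F)) := ⟨_, rfl⟩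
    have hsm₁ : IsLocSmooth (U₁.indicator fun _ => (1 : ℂ)) := by
      rw [hU₁]
      refine isLocSmooth_indicator (hKo.preimage (continuous_const_mul _))
        ((Subgroup.isClosed_of_isOpen _ hKo).preimage (continuous_const_mul _)) ?_
      exact (Homeomorph.isCompact_preimage (Homeomorph.mulLeft ((zS, cu) : GL (Fin 2) F × GL (Fin 1) F)⁻¹)).2 hKc
    have hsm₂ : IsLocSmooth (U₂.indicator fun _ => (1 : ℂ)) := by
      rw [hU₂]
      refine isLocSmooth_indicator (hK'o.preimage (continuous_const_mul _))
        ((Subgroup.isClosed_of_isOpen _ hK'o).preimage (continuous_const_mul _)) ?_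
      exact (Homeomorph.isCompact_preimage (Homeomorph.mulLeft ((zS, cu) : GL (Fin 2) F × GL (Fin 1) F)⁻¹)).2 hK'c
    obtain ⟨ψ₁, hψ₁⟩ : ∃ f : GL (Fin 2) F × GL (Fin 1) F → ℂ, f = U₁.indicator fun _ => (1 : ℂ) := ⟨_, rfl⟩
    obtain ⟨ψB, hψB⟩ : ∃ f : GL (Fin 2) F × GL (Fin 1) F → ℂ, f = U₂.indicator fun _ => (1 : ℂ) := ⟨_, rfl⟩
    have hsψ₁ : IsLocSmooth ψ₁ := by rw [hψ₁]; exact hsm₁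
    have hsψB : IsLocSmooth ψB := by rw [hψB]; exact hsm₂
    have hsψ₂ : IsLocSmooth (ψ₁ - ψB) := ⟨hsψ₁.1.sub hsψB.1, hsψ₁.2.sub hsψB.2⟩
    -- invariances (★ FILE W)
    have hK₁ : ∀ k ∈ (glInt 2 F).prod (glInt 1 F), ∀ y, ψ₁ (k * y * k⁻¹) = ψ₁ y := fun k hk y => by
      simp only [hψ₁, hU₁, Set.indicator_apply, Set.mem_preimage, SetLike.mem_coe, (mem_tests_conj_iff cu hcomm hk y (valuation F ϖ ^ 1)).1]
    have hKB : ∀ k ∈ (glInt 2 F).prod (glInt 1 F), ∀ y, ψB (k * y * k⁻¹) = ψB y := fun k hk y => by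
      simp only [hψB, hU₂, Set.indicator_apply, Set.mem_preimage, SetLike.mem_coe, (mem_tests_conj_iff cu hcomm hk y (valuation F ϖ ^ 1)).2]
    have hK₂ : ∀ k ∈ (glInt 2 F).prod (glInt 1 F), ∀ y, (ψ₁ - ψB) (k * y * k⁻¹) = (ψ₁ - ψB) y := fun k hk y => by
      simp only [Pi.sub_apply, hK₁ k hk y, hKB k hk y]
    have hright₁ : ∀ k ∈ congruenceGL 2 (valuation F ϖ ^ 1), ∀ x : GL (Fin 2) F, ψ₁ (x * k, cu) = ψ₁ (x, cu) := fun k hk x => by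
      simp only [hψ₁, hU₁, Set.indicator_apply, Set.mem_preimage, SetLike.mem_coe, (mem_tests_mul_right_iff (zS := zS) cu hk x).1]
    have hrightB : ∀ k ∈ congruenceGL 2 (valuation F ϖ ^ 1), ∀ x : GL (Fin 2) F, ψB (x * k, cu) = ψB (x, cu) := fun k hk x => by
      simp only [hψB, hU₂, Set.indicator_apply, Set.mem_preimage, SetLike.mem_coe, (mem_tests_mul_right_iff (zS := zS) cu hk x).2]
    have hright₂ : ∀ k ∈ congruenceGL 2 (valuation F ϖ ^ 1), ∀ x : GL (Fin 2) F, (ψ₁ - ψB) (x * k, cu) = (ψ₁ - ψB) (x, cu) :=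
      fun k hk x => by simp only [Pi.sub_apply, hright₁ k hk x, hrightB k hk x]
    -- the shell values at depth one and the central values (★ FILE W `mem_tests_shellConj_one`, `mem_tests_centre`)
    have hshell := fun r : ℕ => mem_tests_shellConj_one hϖ z cu hu hv hγ hrm hzS r
    have hv₁ : ∀ r, ψ₁ ((((rm r)⁻¹, 1) : GL (Fin 2) F × GL (Fin 1) F) * (γ 1, cu) * (((rm r)⁻¹, 1) : GL (Fin 2) F × GL (Fin 1) F)⁻¹) =
        if r ≤ 1 then 1 else 0 := fun r => by
      simp only [hψ₁, hU₁, Set.indicator_apply, Set.mem_preimage, SetLike.mem_coe, (hshell r).1]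
    have hvB : ∀ r, ψB ((((rm r)⁻¹, 1) : GL (Fin 2) F × GL (Fin 1) F) * (γ 1, cu) * (((rm r)⁻¹, 1) : GL (Fin 2) F × GL (Fin 1) F)⁻¹) =
        if r = 0 then 1 else 0 := fun r => by
      simp only [hψB, hU₂, Set.indicator_apply, Set.mem_preimage, SetLike.mem_coe, (hshell r).2]
    have hc₁ : ψ₁ (zS, cu) = 1 := by
      simp only [hψ₁, hU₁, Set.indicator_apply, Set.mem_preimage, SetLike.mem_coe, (mem_tests_centre (zS := zS) cu (valuation F ϖ ^ 1)).1, if_true]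
    have hcB : ψB (zS, cu) = 1 := by
      simp only [hψB, hU₂, Set.indicator_apply, Set.mem_preimage, SetLike.mem_coe, (mem_tests_centre (zS := zS) cu (valuation F ϖ ^ 1)).2, if_true]
    have hR₁ : ∀ r, 2 ≤ r → ψ₁ ((((rm r)⁻¹, 1) : GL (Fin 2) F × GL (Fin 1) F) * (γ 1, cu) * (((rm r)⁻¹, 1) : GL (Fin 2) F × GL (Fin 1) F)⁻¹) = 0 :=
      fun r hr => by rw [hv₁, if_neg (by omega)]
    have hR₂ : ∀ r, 2 ≤ r → (ψ₁ - ψB) ((((rm r)⁻¹, 1) : GL (Fin 2) F × GL (Fin 1) F) * (γ 1, cu) * (((rm r)⁻¹, 1) : GL (Fin 2) F × GL (Fin 1) F)⁻¹) = 0 :=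
      fun r hr => by rw [Pi.sub_apply, hv₁, hvB, if_neg (by omega), if_neg (by omega), sub_zero]
    -- ★ FILE E at depth `1 + k` for both witnesses; `S_1(ψ₁) = 1 + q`, `S_1(ψ₂) = q`
    have hgerm₁ := fun k : ℕ => orbitalIntegral_deep_eq_closedForm hϖ hu hu1 hv1 hdisc z cu hγτ hγ hrm hzS ν hsψ₁.continuous hsψ₁.2 hK₁ le_rfl hright₁ hR₁ k
    have hgerm₂ := fun k : ℕ => orbitalIntegral_deep_eq_closedForm hϖ hu hu1 hv1 hdisc z cu hγτ hγ hrm hzS ν hsψ₂.continuous hsψ₂.2 hK₂ le_rfl hright₂ hR₂ k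
    have hS₁ : ∑ r ∈ Finset.range 2, ((Nat.card (IsLocalRing.ResidueField 𝒪[F]) : ℂ) ^ r) *
        ψ₁ ((((rm r)⁻¹, 1) : GL (Fin 2) F × GL (Fin 1) F) * (γ 1, cu) * (((rm r)⁻¹, 1) : GL (Fin 2) F × GL (Fin 1) F)⁻¹) =
        1 + (Nat.card (IsLocalRing.ResidueField 𝒪[F]) : ℂ) := by
      rw [Finset.sum_range_succ, Finset.sum_range_succ, Finset.sum_range_zero, hv₁, hv₁, if_pos (by omega), if_pos le_rfl]
      ring
    have hS₂ : ∑ r ∈ Finset.range 2, ((Nat.card (IsLocalRing.ResidueField 𝒪[F]) : ℂ) ^ r) *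
        (ψ₁ - ψB) ((((rm r)⁻¹, 1) : GL (Fin 2) F × GL (Fin 1) F) * (γ 1, cu) * (((rm r)⁻¹, 1) : GL (Fin 2) F × GL (Fin 1) F)⁻¹) =
        (Nat.card (IsLocalRing.ResidueField 𝒪[F]) : ℂ) := by
      rw [Finset.sum_range_succ, Finset.sum_range_succ, Finset.sum_range_zero, Pi.sub_apply, Pi.sub_apply, hv₁, hv₁, hvB, hvB,
        if_pos (by omega), if_pos le_rfl, if_pos rfl, if_neg one_ne_zero]
      ring
    have hc₂ : (ψ₁ - ψB) (zS, cu) = 0 := by rw [Pi.sub_apply, hc₁, hcB, sub_self]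
    refine ⟨ψ₁, ψ₁ - ψB,
      -((ν ((glInt 2 F).prod (glInt 1 F))).toReal : ℂ) / ((Nat.card (IsLocalRing.ResidueField 𝒪[F]) : ℂ) - 1),
      ((ν ((glInt 2 F).prod (glInt 1 F))).toReal : ℂ) * (Nat.card (IsLocalRing.ResidueField 𝒪[F]) : ℂ) /
        ((Nat.card (IsLocalRing.ResidueField 𝒪[F]) : ℂ) - 1),
      0, ((ν ((glInt 2 F).prod (glInt 1 F))).toReal : ℂ), hsψ₁, hsψ₂, ?_, ?_, ?_⟩
    · refine Filter.eventually_atTop.2 ⟨1, fun n hn => ?_⟩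
      obtain ⟨k, rfl⟩ := Nat.exists_eq_add_of_le hn
      intro ρ _ _ hρ
      refine (hgerm₁ k ρ hρ).trans ?_
      rw [hS₁, hc₁]
      beta_reduce
      rw [pow_add, pow_one]
      field_simp
      ring
    · refine Filter.eventually_atTop.2 ⟨1, fun n hn => ?_⟩
      obtain ⟨k, rfl⟩ := Nat.exists_eq_add_of_le hn
      intro ρ _ _ hρ
      refine (hgerm₂ k ρ hρ).trans ?_
      rw [hS₂, hc₂]
      beta_reduce
      rw [pow_add, pow_one, zero_div, add_zero, sub_zero, zero_add]
      ring
    · rw [zero_mul, sub_zero]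
      exact mul_ne_zero (div_ne_zero (neg_ne_zero.2 hw0) hq1) hw0

end Main

end Summit.HodgeConjecture.HodgeConjecture.Cruxes.H413.K2E3GLTwoCentralGermRamifiedRay

end
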